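import Summits.ABC.ABC.Theses.YuMatveevShapeRat
import Summits.ABC.ABC.Theorems.YuMatveevShapeRatArchCoreRatLine
import Summits.ABC.ABC.Theorems.YuMatveevShapeRatPadicCoreOddRatLine
import Summits.ABC.ABC.Theorems.YuMatveevShapeRatPadicCoreTwoRatLine
import HarnessLib

/-!
# Rung F-A1.L by name: the Baker-method library rung over `ℚ` (`Dioph.approximationBound_rat`) — UNCONDITIONAL

`Summits/ABC/ABC/Theorems/YuMatveevShapeRatCloses.lean` — cell `abc-stewartyu` (HOME `run/shared/lean/pub/abc-stewartyu/`), route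
`YuMatveevShapeRat` (planner g11/g12), seat p2 (g8, KEY R4SUPPORT-ASSEMBLY), filed right after BOTH remaining crux closers landed:
`ArchCoreRat` (stmt-ABC-20502, line `arch_g3_frame`, `…ArchG3Frame.archCoreRat_proof`, p4 g10, 2026-08-27T23:18Z), `PadicCoreTwoRat`
(stmt-ABC-20504, line `padic_two_sat_frame`, `Summit.ABC.ABC.Theorems.PadicCoreTwoRat_proof`, p3 g10); `PadicCoreOddRat` (stmt-ABC-20503, line `sat_odd`) is `PadicCoreOddRat_proof` (✓ p572760).  The route's `closes`
(= lp-1's `Dioph.approximationBound_rat_of_cores`) composes them into the rung leaf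
`Literature.NumberTheory.DiophantineGeometry.Dioph.approximationBound_rat` = `∃ K ≥ 1, PastenApproximationBound K`.
BY-NAME consumers in the tree (all `K`-parametric) fire from this decl: `Dioph.archApproximationBound_rat_of` / `padicApproximationBound_rat_of`
(the two halves A1.L(∞)/A1.L(p)), `Literature.Barriers.ABC.BakerMethodBounds_of_approximationBound_rat` (A1.M3 by a second path),
`stewartYu2001_thm2_of_approximationBound_rat` (A1.M3⁺), the Pasten–Sepúlveda-Manzo 2025 theorems (`SubexponentialAbcWithoutRadAHolds.lean`).
Also by this decl: the Baker-method ladder a SECOND time, Kummer-door-free (`…_of_approximationBound_rat`; not re-declared — those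
statements are theorems already and the gate de-duplicates by statement), and the LFL input `∃ K ≥ 1, PastenApproximationBound K` of the
few-prime valuation-product line of route `RibetTakahashiSplit` (`stub_lflInput`, stmt-ABC-1563) is this statement unfolded.
[folklore] assembly (M3 precedent: `StewartYuHolds.lean`).
WHAT THIS IS NOT: an abc claim; no summit credit (class rung, FRONTIER ledger, D-0061).
-/

-- `Summit.<Summit>.<Problem>` is the mandated summit-side namespace (CONVENTIONS §2); for the single-conjunct summit `ABC` the two
-- coincide, so the duplicate `ABC.ABC` is deliberate.
set_option linter.dupNamespace false

namespace Summit.ABC.ABC.Theorems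

open Summit.ABC.ABC.Theses
open Literature.NumberTheory.DiophantineGeometry

/-- **Rung F-A1.L — the approximation bound over `ℚ` in shape form holds**: `∃ K ≥ 1, PastenApproximationBound K` (Pasten 2024 Thm 2.1,
`d = 1`; Evertse–Győry Thm 4.2.1 over `ℚ` at `α = 1`), from the three Kummer-free engine cores through the route's `closes`.
[cite: Pasten2024, Theorem 2.1 (d = 1)] [cite: EvertseGyory2015, Thm 4.2.1 (p. 68), K = ℚ, α = 1] -/
theorem approximationBound_rat_holds : Dioph.approximationBound_rat :=
  YuMatveevShapeRat.closes
    Summit.ABC.ABC.Cruxes.ArchCoreRat.ArchG3Frame.archCoreRat_proof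
    Summit.ABC.ABC.Cruxes.PadicCoreOddRat.SatOddG3Frame.PadicCoreOddRat_proof
    Summit.ABC.ABC.Theorems.PadicCoreTwoRat_proof

/-- The archimedean half A1.L(∞) by name (the `p`-adic half A1.L(p) is `padicApproximationBound_rat_holds`, file
`YuMatveevShapeRatPadicHalf.lean`, from the two `p`-adic cores alone). [cite: Pasten2024, Theorem 2.1 (i) (d = 1)] -/
theorem archApproximationBound_rat_holds : Dioph.archApproximationBound_rat :=
  Dioph.archApproximationBound_rat_of approximationBound_rat_holds

end Summit.ABC.ABC.Theorems
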